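import Literature.AlgebraicGeometry.ShimuraVarieties.UnitaryBallAutomorphicForms
import HarnessLib

/-!
# Translates of holomorphic `(1,0)`-form sections on the ball are holomorphic

For `γ ∈ U(2,1)` and a holomorphic section `F : 𝔹² → ℂ²` (coefficients of a `(1,0)`-form
`Σ Fᵢ dzᵢ`), the pulled-back section `γ^* F : z ↦ (Jac γ z)ᵀ F(γ z)` is again holomorphic: `γ` acts
on `𝔹²` by a linear fractional (hence holomorphic) transformation whose Jacobian matrix has entries
rational in `z` with non-vanishing denominator `w₂(z) = (γ·(z,1))₂` on the ball.

* `BallForms.homogAmb γ y = γ·(y,1)` and `BallForms.JacAmb γ y` — the ambient (`y ∈ ℂ²`) versions of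
  the homogeneous coordinates `W3` and of the Jacobian `Jac`, agreeing with them on the ball
  (`homogAmb_coe`, `JacAmb_coe`), complex-differentiable at every point of the ball;
* `BallForms.translate_mem_holomorphic` — **`z ↦ (Jac γ z)ᵀ F(γ z)` is holomorphic for holomorphic
  `F`** (the chain rule: `hasFDerivAt_actVec`, `hasFDerivAt_homog` of the tree).

This is the analytic input of the translation clause of the theta/ball dictionary (a left translate
`g ↦ u(γ g)` of the group function of a holomorphic weight form is the group function of the
holomorphic weight form `γ^* F`, Borel §5.13–5.14). PROVED lemma (Mathlib + tree); no new axioms.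
[cite: Borel1997, §5.13–5.14]
-/

noncomputable section

open Matrix

namespace Literature.AlgebraicGeometry.ShimuraVarieties

namespace BallForms

open Literature.Geometry.ComplexHyperbolic Literature.Geometry.ComplexHyperbolic.BallModel

/-- Ambient homogeneous coordinates `y ↦ γ·(y₀, y₁, 1)` on all of `ℂ²`. [folklore] -/
def homogAmb (γ : U21) (y : Fin 2 → ℂ) : Fin 3 → ℂ := mat γ *ᵥ ![y 0, y 1, 1]

/-- On the ball `homogAmb γ z = W3 γ z`. [folklore] -/
theorem homogAmb_coe (γ : U21) (z : Ball) : homogAmb γ z.1 = W3 γ z := rfl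

/-- Ambient Jacobian formula `((γ_{ij} w₂ - w_i γ_{2j}) / w₂²)_{ij}` with `w = γ·(y,1)`. [folklore] -/
def JacAmb (γ : U21) (y : Fin 2 → ℂ) : Matrix (Fin 2) (Fin 2) ℂ :=
  Matrix.of fun i j => (mat γ (Fin.castSucc i) (Fin.castSucc j) * homogAmb γ y 2 -
    homogAmb γ y (Fin.castSucc i) * mat γ 2 (Fin.castSucc j)) / homogAmb γ y 2 ^ 2

/-- On the ball `JacAmb γ z = Jac γ z`. [folklore] -/
theorem JacAmb_coe (γ : U21) (z : Ball) : JacAmb γ z.1 = Jac γ z := rfl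

/-- The homogeneous coordinates are complex-differentiable (affine in `y`). [folklore] -/
theorem differentiableAt_homogAmb (γ : U21) (k : Fin 3) (y : Fin 2 → ℂ) :
    DifferentiableAt ℂ (fun y ↦ homogAmb γ y k) y :=
  (hasFDerivAt_homog γ k y).differentiableAt

/-- `w₂ ≠ 0` on the ball. [folklore] -/
theorem homogAmb_two_ne_zero (γ : U21) {y : Fin 2 → ℂ} (hy : y ∈ ballSet) : homogAmb γ y 2 ≠ 0 :=
  W3_2_ne_zero γ ⟨y, hy⟩

/-- The entries of the ambient Jacobian are complex-differentiable at the points of the ball. [folklore] -/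
theorem differentiableAt_JacAmb_apply (γ : U21) (i j : Fin 2) {y : Fin 2 → ℂ} (hy : y ∈ ballSet) :
    DifferentiableAt ℂ (fun y ↦ JacAmb γ y i j) y := by
  have h2 : homogAmb γ y 2 ^ 2 ≠ 0 := pow_ne_zero _ (homogAmb_two_ne_zero γ hy)
  have hnum : DifferentiableAt ℂ (fun y ↦ mat γ (Fin.castSucc i) (Fin.castSucc j) * homogAmb γ y 2 -
      homogAmb γ y (Fin.castSucc i) * mat γ 2 (Fin.castSucc j)) y :=
    ((differentiableAt_homogAmb γ 2 y).const_mul _).fun_sub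
      ((differentiableAt_homogAmb γ _ y).mul_const _)
  have hden : DifferentiableAt ℂ (fun y ↦ (homogAmb γ y 2 ^ 2)⁻¹) y :=
    ((differentiableAt_homogAmb γ 2 y).fun_pow 2).fun_inv h2
  simp only [JacAmb, Matrix.of_apply, div_eq_mul_inv]
  exact hnum.fun_mul hden

/-- The coordinate action map is complex-differentiable at the points of the ball. [folklore] -/
theorem differentiableAt_actVec (γ : U21) {y : Fin 2 → ℂ} (hy : y ∈ ballSet) :
    DifferentiableAt ℂ (actVec γ) y :=
  (hasFDerivAt_actVec γ ⟨y, hy⟩).differentiableAt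

/-- The coordinate action map preserves the ball. [folklore] -/
theorem actVec_mem_ballSet (γ : U21) {y : Fin 2 → ℂ} (hy : y ∈ ballSet) : actVec γ y ∈ ballSet := by
  rw [show y = (⟨y, hy⟩ : Ball).1 from rfl, actVec_eq]
  exact coe_mem_ballSet _

/-- On the ball, the extension by zero of `γ^* F` is the ambient expression
`(JacAmb γ y)ᵀ F̃(γ y)`. [folklore] -/
theorem extend_translate_apply (γ : U21) (F : Ball → (Fin 2 → ℂ)) (z : Ball) :
    extend (Fin 2 → ℂ) (fun z ↦ (Jac γ z)ᵀ *ᵥ F (γ • z)) z.1 =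
      (JacAmb γ z.1)ᵀ *ᵥ extend (Fin 2 → ℂ) F (actVec γ z.1) := by
  rw [extend_apply_coe, JacAmb_coe, actVec_eq, extend_apply_coe]

/-- **Translates of holomorphic `(1,0)`-sections are holomorphic**: for `γ ∈ U(2,1)` and holomorphic
`F : 𝔹² → ℂ²`, the section `γ^* F : z ↦ (Jac γ z)ᵀ F(γ z)` is holomorphic. [cite: Borel1997, §5.13–5.14] -/
theorem translate_mem_holomorphic (γ : U21) {F : Ball → (Fin 2 → ℂ)}
    (hF : F ∈ holomorphic (Fin 2 → ℂ)) :
    (fun z ↦ (Jac γ z)ᵀ *ᵥ F (γ • z)) ∈ holomorphic (Fin 2 → ℂ) := by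
  rw [mem_holomorphic_iff] at hF ⊢
  -- the coordinate action map is differentiable on the ball and preserves it
  have hact : DifferentiableOn ℂ (actVec γ) ballSet :=
    fun y hy ↦ (differentiableAt_actVec γ hy).differentiableWithinAt
  -- the pulled-back coefficient vector `y ↦ F̃(γ y)` is differentiable on the ball
  have hv : DifferentiableOn ℂ (fun y ↦ extend (Fin 2 → ℂ) F (actVec γ y)) ballSet :=
    hF.comp hact fun y hy ↦ actVec_mem_ballSet γ hy
  -- hence so is the ambient expression `(JacAmb γ y)ᵀ F̃(γ y)`, componentwise a sum of products
  have hΦ : DifferentiableOn ℂ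
      (fun y ↦ (JacAmb γ y)ᵀ *ᵥ extend (Fin 2 → ℂ) F (actVec γ y)) ballSet := by
    refine differentiableOn_pi.2 fun i ↦ ?_
    have hcomp : ∀ j : Fin 2, DifferentiableOn ℂ
        (fun y ↦ JacAmb γ y j i * extend (Fin 2 → ℂ) F (actVec γ y) j) ballSet := fun j ↦ by
      have hJ : DifferentiableOn ℂ (fun y ↦ JacAmb γ y j i) ballSet :=
        fun y hy ↦ (differentiableAt_JacAmb_apply γ j i hy).differentiableWithinAt
      exact hJ.fun_mul (differentiableOn_pi.1 hv j)
    refine (DifferentiableOn.fun_sum (u := Finset.univ) fun j _ ↦ hcomp j).congr fun y _ ↦ ?_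
    simp [Matrix.mulVec, dotProduct]
  -- and it agrees with the extension of `γ^* F` on the ball
  exact hΦ.congr fun y hy ↦ extend_translate_apply γ F ⟨y, hy⟩

end BallForms

end Literature.AlgebraicGeometry.ShimuraVarieties

end
-- build re-queue 2026-08-21T18:23:28Z (C-7 stale olean; ops/buildfix word 18:3xZ): comment-only, no declaration changed
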